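import Mathlib

/-!
# The (2,2) cluster split of the four-level Hankel determinants — kernel anchors

Kernel-checked algebra behind Proposition G.6 of the repair-cell note
`pub-imbrie/b2b-imbrie-2/DENSITY-XY.md` ADDENDUM G (the proof of the four-level target T4,
`sup_λ K₄(λ) < ∞`, for the push-forward density of Lebesgue measure under the spectral map of a
`4`-site Jacobi matrix). With the first-site spectral weights written in cluster coordinates for
the split `{ν₁, ν₂} ⊔ {ν₃, ν₄}`,
`w = ((1-τ)x, (1-τ)(1-x), τy, τ(1-y))`, the Hankel determinants
`D_k(w) = Σ_{|S|=k} ∏_{i∈S} w_i Δ(ν_S)²` regroup as (Lemma 5.12 there, the instance `m = 4`,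
`|A| = |B| = 2`):

* `clusterSplit₂₂_D2` — `D₂ = (1-τ)² x(1-x)(ν₂-ν₁)² + τ(1-τ)·M + τ² y(1-y)(ν₄-ν₃)²`,
  `M = Σ_{i∈A, j∈B} α_i β_j (ν_j-ν_i)²`;
* `clusterSplit₂₂_D3` — `D₃ = (1-τ)²τ·x(1-x)(ν₂-ν₁)²·N_B + (1-τ)τ²·y(1-y)(ν₄-ν₃)²·N_A`;
* `clusterSplit₂₂_D4` — `D₄ = (1-τ)²τ²·x(1-x)y(1-y)(ν₂-ν₁)²(ν₄-ν₃)²·Ξ`,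
  `Ξ = ∏_{i∈A, j∈B}(ν_j-ν_i)²`;
* `clusterSplit₂₂_vandermonde` — `Δ(ν)² = (ν₂-ν₁)²(ν₄-ν₃)²·Ξ`.

Pure regrouping identities (`ring`); no new definitions; no `sorry`.
-/

namespace Literature.MathematicalPhysics.QuantumLattice.Imbrie2016

/-- Lemma 5.12 at `(2,2)`, `k = 2`: the pair sum `D₂(w) = Σ_{i<j} w_i w_j (ν_j-ν_i)²` in cluster
coordinates.  [cite: ImbrieJSP2016, §4.2.1]  [folklore] -/
theorem clusterSplit₂₂_D2 (τ x y ν₁ ν₂ ν₃ ν₄ : ℝ) :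
    ((1 - τ) * x) * ((1 - τ) * (1 - x)) * (ν₂ - ν₁) ^ 2
      + ((1 - τ) * x) * (τ * y) * (ν₃ - ν₁) ^ 2
      + ((1 - τ) * x) * (τ * (1 - y)) * (ν₄ - ν₁) ^ 2
      + ((1 - τ) * (1 - x)) * (τ * y) * (ν₃ - ν₂) ^ 2
      + ((1 - τ) * (1 - x)) * (τ * (1 - y)) * (ν₄ - ν₂) ^ 2
      + (τ * y) * (τ * (1 - y)) * (ν₄ - ν₃) ^ 2
    = (1 - τ) ^ 2 * (x * (1 - x)) * (ν₂ - ν₁) ^ 2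
      + τ * (1 - τ) *
          (x * y * (ν₃ - ν₁) ^ 2 + x * (1 - y) * (ν₄ - ν₁) ^ 2
            + (1 - x) * y * (ν₃ - ν₂) ^ 2 + (1 - x) * (1 - y) * (ν₄ - ν₂) ^ 2)
      + τ ^ 2 * (y * (1 - y)) * (ν₄ - ν₃) ^ 2 := by
  ring

/-- Lemma 5.12 at `(2,2)`, `k = 3`: the triple sum `D₃(w) = Σ_{|S|=3} ∏_S w · Δ(ν_S)²` splits into
the `(2,1)`-term `(1-τ)²τ·X p²·N_B` and the `(1,2)`-term `(1-τ)τ²·Y q²·N_A`.  [folklore] -/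
theorem clusterSplit₂₂_D3 (τ x y ν₁ ν₂ ν₃ ν₄ : ℝ) :
    ((1 - τ) * x) * ((1 - τ) * (1 - x)) * (τ * y)
        * ((ν₂ - ν₁) ^ 2 * (ν₃ - ν₁) ^ 2 * (ν₃ - ν₂) ^ 2)
      + ((1 - τ) * x) * ((1 - τ) * (1 - x)) * (τ * (1 - y))
        * ((ν₂ - ν₁) ^ 2 * (ν₄ - ν₁) ^ 2 * (ν₄ - ν₂) ^ 2)
      + ((1 - τ) * x) * (τ * y) * (τ * (1 - y))
        * ((ν₃ - ν₁) ^ 2 * (ν₄ - ν₁) ^ 2 * (ν₄ - ν₃) ^ 2)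
      + ((1 - τ) * (1 - x)) * (τ * y) * (τ * (1 - y))
        * ((ν₃ - ν₂) ^ 2 * (ν₄ - ν₂) ^ 2 * (ν₄ - ν₃) ^ 2)
    = (1 - τ) ^ 2 * τ * (x * (1 - x)) * (ν₂ - ν₁) ^ 2 *
          (y * ((ν₃ - ν₁) ^ 2 * (ν₃ - ν₂) ^ 2) + (1 - y) * ((ν₄ - ν₁) ^ 2 * (ν₄ - ν₂) ^ 2))
      + (1 - τ) * τ ^ 2 * (y * (1 - y)) * (ν₄ - ν₃) ^ 2 *
          (x * ((ν₃ - ν₁) ^ 2 * (ν₄ - ν₁) ^ 2) + (1 - x) * ((ν₃ - ν₂) ^ 2 * (ν₄ - ν₂) ^ 2)) := by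
  ring

/-- Lemma 5.12 at `(2,2)`, `k = 4`: `D₄(w) = (∏ w)·Δ(ν)²` with the Vandermonde factorised across
the split.  [folklore] -/
theorem clusterSplit₂₂_D4 (τ x y ν₁ ν₂ ν₃ ν₄ : ℝ) :
    ((1 - τ) * x) * ((1 - τ) * (1 - x)) * (τ * y) * (τ * (1 - y))
        * ((ν₂ - ν₁) ^ 2 * (ν₃ - ν₁) ^ 2 * (ν₄ - ν₁) ^ 2
            * (ν₃ - ν₂) ^ 2 * (ν₄ - ν₂) ^ 2 * (ν₄ - ν₃) ^ 2)
    = (1 - τ) ^ 2 * τ ^ 2 * (x * (1 - x)) * (y * (1 - y)) * (ν₂ - ν₁) ^ 2 * (ν₄ - ν₃) ^ 2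
        * ((ν₃ - ν₁) ^ 2 * (ν₄ - ν₁) ^ 2 * (ν₃ - ν₂) ^ 2 * (ν₄ - ν₂) ^ 2) := by
  ring

/-- The Vandermonde of four levels factorised across the `(2,2)` split:
`Δ(ν)² = p² q² Ξ` with `p = ν₂-ν₁`, `q = ν₄-ν₃`, `Ξ = ∏_{i∈A,j∈B}(ν_j-ν_i)²`.  [folklore] -/
theorem clusterSplit₂₂_vandermonde (ν₁ ν₂ ν₃ ν₄ : ℝ) :
    ((ν₂ - ν₁) * (ν₃ - ν₁) * (ν₄ - ν₁) * (ν₃ - ν₂) * (ν₄ - ν₂) * (ν₄ - ν₃)) ^ 2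
    = (ν₂ - ν₁) ^ 2 * (ν₄ - ν₃) ^ 2
        * ((ν₃ - ν₁) ^ 2 * (ν₄ - ν₁) ^ 2 * (ν₃ - ν₂) ^ 2 * (ν₄ - ν₂) ^ 2) := by
  ring

/-- Pattern domination (used for every word of ADDENDUM G): a sum of two non-negative terms is
within a factor `2` of the larger one.  [folklore] -/
theorem le_two_mul_of_dominant {a b : ℝ} (hb : 0 ≤ b) (hba : b ≤ a) :
    a ≤ a + b ∧ a + b ≤ 2 * a := by
  constructor <;> linarith

end Literature.MathematicalPhysics.QuantumLattice.Imbrie2016
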